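import Literature.AlgebraicGeometry.AbelianSchemes.RigidifiedGluingOfCechPic
import Literature.AlgebraicGeometry.Modules.CechPicDescentAlongSection
import Literature.AlgebraicGeometry.Modules.CechPicTrivOnOfOpenImmersion
import Literature.AlgebraicGeometry.Motives.PushforwardStructureSheaf
import HarnessLib

/-!
# Rigidified gluing for `A_T → T` Stein, and for an abelian variety over a field

Layer `Literature/AlgebraicGeometry/AbelianSchemes`, namespace `Literature.AlgebraicGeometry.AbelianSchemes`
(dot notation on `AbelianSchemeOver`).  Setting as in `AbelianSchemes/PoincareUniversalLocality`.

* §1 For `π : A_T → T` with `π^♯` bijective on every open of `T` («Stein»), a Čech class in `CechPic A_T` that pulls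
  back to `1` on every `A_{U_i}` (`U_i` an open cover of `T`) and along the zero section `ε_T` is `1`
  (**`cechPic_eq_one_of_cover_of_unitSection`**): `A_{U_i} → A_T` is the base change `pullback.fst π (U_i → T)` up
  to Mathlib's `pullbackLeftPullbackSndIso`, so its range is `π⁻¹(U_i)`; the class is trivialised there
  (`UnitCocycle.trivOnOfPullbackEqOne`, `Modules/CechPicTrivOnOfOpenImmersion`), hence presented along `π`
  (`CechPic.mk_eq_mk_presented_of_trivOn`, `Modules/CechPicSaturatedCover`), hence `1`
  (`CechPic.mk_presented_eq_one_of_section` with the zero section, `Modules/CechPicDescentAlongSection`).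
  With `rigidifiedGluing_of_cechPic` (`AbelianSchemes/RigidifiedGluingOfCechPic`): **`rigidifiedGluing_of_stein`** —
  `RigidifiedGluing A B 𝒫` for `𝒫` of rank one and `A_T → T` Stein for every `T`.
* §2 For an abelian variety `A₀` over a field `K`, `A₀ ×_K T → T` is Stein for every `K`-scheme `T`
  (`stein_ofAbelianVariety`, from `Motives/PushforwardStructureSheaf`: `A₀ → Spec K` is proper and geometrically
  integral), hence **`rigidifiedGluing_ofAbelianVariety`** — `(ofAbelianVariety A₀).RigidifiedGluing B 𝒫` for every
  abelian scheme `B / K` and every rank-one `𝒫` on `A₀ ×_K B`: the gluing hypothesis of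
  `existsUnique_classify_of_affine` holds in this case.

This is the gluing step of [MumfordAV1970, §13, proof of the Thm. p. 125] (normalised isomorphisms of rigidified line
bundles are unique by [MumfordAV1970, §5 Cor. 6], so local ones glue), in Čech form over an arbitrary test scheme
`T` ([GortzWedhorn2023, Thm. 24.66, Lemma 24.67]).  Everything is proved; no named facts.

## References
* [MumfordAV1970] D. Mumford, *Abelian Varieties* (1970), §13 (proof of the Thm. p. 125), §5 Cor. 6 (p. 54).
* [MilneAV2008] J. S. Milne, *Abelian Varieties* (v2.00, 2008), I §8 (proof of Thm. 8.9, pp. 36–37).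
* [GortzWedhorn2023] U. Görtz, T. Wedhorn, *Algebraic Geometry II: Cohomology of Schemes* (2023), Thm. 24.66, Lemma 24.67 (p. 406), Cor. 24.63 (p. 404).
* [GortzWedhorn2020] U. Görtz, T. Wedhorn, *Algebraic Geometry I*, 2nd ed. (2020), Section (4.7) (pp. 107–108).
* [Hartshorne1977] R. Hartshorne, *Algebraic Geometry*, GTM 52 (1977), II Ex. 6.8 (a).
-/

universe u

open CategoryTheory CategoryTheory.Limits AlgebraicGeometry MonoidalCategory

noncomputable section

-- `Scheme.Modules` / `SheafOfModules` are not reducible (as in Mathlib's `AlgebraicGeometry/Modules/Sheaf.lean`).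
set_option backward.isDefEq.respectTransparency false

namespace Literature.AlgebraicGeometry.AbelianSchemes

open Literature.AlgebraicGeometry.Motives Literature.AlgebraicGeometry.AbelianVarieties
  Literature.AlgebraicGeometry.Modules

namespace AbelianSchemeOver

variable {S : Scheme.{u}} (A : AbelianSchemeOver S)
/-! ### §1 The class-level key and rigidified gluing for `A_T → T` Stein

For `π := (A_T → T)` with `π^♯` bijective on all opens («Stein»; `Motives.PushforwardStructureSheaf.isIso_app_snd`
for `A := ofAbelianVariety A₀`, §2), a Čech class on `A_T` that dies on every `A_{U_i}` (`U_i` an open cover of `T`) and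
along `ε_T` is trivial: `A_{U_i} → A_T` is the base change `pullback.fst π (U_i → T)` up to Mathlib's
`pullbackLeftPullbackSndIso` (so its range is `π⁻¹(U_i)`, `Scheme.Hom.opensRange_pullbackFst`), the class is
trivialised there (`trivOnOfPullbackEqOne`), hence presented along `π` (`mk_eq_mk_presented_of_trivOn`), hence `1`
(`mk_presented_eq_one_of_section` with the identity section). -/

section KeyAssembly

open Literature.AlgebraicGeometry.Modules

variable (B : AbelianSchemeOver S) (P : (A.prodLeft B).Modules)

/-- `A_U ≅ (A_T) ×_T U` matches `1_A × u` with the base-change projection `pullback.fst π u`.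
[cite: GortzWedhorn2020, Section (4.7) (pp. 107–108)] -/
theorem pullbackLeftPullbackSndIso_hom_comp_prodMap {T U : Scheme.{u}} (f : T ⟶ S) (u : U ⟶ T) :
    (pullbackLeftPullbackSndIso A.X.hom f u).hom ≫ A.prodMap (u ≫ f) f u rfl =
      pullback.fst (pullback.snd A.X.hom f) u := by
  apply pullback.hom_ext
  · rw [Category.assoc, prodMap_fst, pullbackLeftPullbackSndIso_hom_fst]
  · rw [Category.assoc, prodMap_snd, ← Category.assoc, pullbackLeftPullbackSndIso_hom_snd]
    exact pullback.condition.symm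

/-- A class dying on `A_U` (along `1_A × u`) dies along the base-change projection `(A_T) ×_T U → A_T`.
[cite: Hartshorne1977, II Ex. 6.8 (a)] -/
theorem cechPic_pullback_fst_eq_one {T U : Scheme.{u}} (f : T ⟶ S) (u : U ⟶ T)
    (c : CechPic (A.baseChange f).X.left) (h : CechPic.pullback (A.prodMap (u ≫ f) f u rfl) c = 1) :
    CechPic.pullback (pullback.fst (A.baseChange f).X.hom u) c = 1 := by
  have e : pullback.fst (A.baseChange f).X.hom u =
      (pullbackLeftPullbackSndIso A.X.hom f u).hom ≫ A.prodMap (u ≫ f) f u rfl :=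
    (A.pullbackLeftPullbackSndIso_hom_comp_prodMap f u).symm
  calc CechPic.pullback (pullback.fst (A.baseChange f).X.hom u) c
      = CechPic.pullback ((pullbackLeftPullbackSndIso A.X.hom f u).hom ≫ A.prodMap (u ≫ f) f u rfl) c := by
          rw [e]; rfl
    _ = CechPic.pullback (pullbackLeftPullbackSndIso A.X.hom f u).hom
          (CechPic.pullback (A.prodMap (u ≫ f) f u rfl) c) := CechPic.pullback_comp _ _ _
    _ = 1 := by rw [h, map_one]

/-- **THE CLASS-LEVEL KEY** (the `hkey` of `rigidifiedGluing_of_cechPic`), for `A_T → T` Stein on every `T`: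
a Čech class on `A_T` trivial on every `A_{U_i}` and along `ε_T` is trivial.
[cite: MumfordAV1970, §13 (proof of the Thm. p. 125) with §5 Cor. 6 (p. 54)] [cite: GortzWedhorn2023, Lemma 24.67, Thm. 24.66] -/
theorem cechPic_eq_one_of_cover_of_unitSection
    (hStein : ∀ {T : Scheme.{u}} (f : T ⟶ S) (W : T.Opens), Function.Bijective ((A.baseChange f).X.hom.app W))
    {T : Scheme.{u}} (f : T ⟶ S) (𝒰 : Scheme.OpenCover.{u} T) (c : CechPic (A.baseChange f).X.left)
    (hloc : ∀ i, CechPic.pullback (A.prodMap (𝒰.f i ≫ f) f (𝒰.f i) rfl) c = 1)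
    (hε : CechPic.pullback (A.baseChange f).unitSection c = 1) : c = 1 := by
  obtain ⟨γ, rfl⟩ := CechPic.mk_surjective c
  -- trivialisations over the members `π⁻¹(U_i)` of the saturated cover
  have t : ∀ i, γ.TrivOn ((A.baseChange f).X.hom ⁻¹ᵁ (𝒰.f i).opensRange) := fun i =>
    (UnitCocycle.trivOnOfPullbackEqOne (ρ := pullback.fst (A.baseChange f).X.hom (𝒰.f i)) γ
      (A.cechPic_pullback_fst_eq_one f (𝒰.f i) _ (hloc i))).ofEq γ (Scheme.Hom.opensRange_pullbackFst _ _)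
  -- presented along `π`
  obtain ⟨G, hmul, hunit, gX, hUX, hgX, hγ⟩ :=
    CechPic.mk_eq_mk_presented_of_trivOn (A.baseChange f).X.hom (hStein f) (fun i => (𝒰.f i).opensRange) 𝒰.idx
      (fun x => 𝒰.covers x) γ t
  rw [hγ] at hε ⊢
  -- and killed by the identity section
  exact CechPic.mk_presented_eq_one_of_section (π := (A.baseChange f).X.hom) (idx := 𝒰.idx)
    (A := fun i => (𝒰.f i).opensRange) (G := G) (A.baseChange f).unitSection (A.baseChange f).unitSection_comp_hom
    (fun x => 𝒰.covers x) hmul hunit hUX hgX hε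

/-- **Rigidified gluing for `A_T → T` Stein**: for `𝒫` of rank one and `A_T → T` with `π^♯` bijective
on all opens for every `T` (true for `A := ofAbelianVariety A₀`, §2), `A.RigidifiedGluing B 𝒫` holds. [cite: MumfordAV1970, §13 (proof of the Thm. p. 125)] [cite: MilneAV2008, I §8 (proof of Thm. 8.9)] -/
theorem rigidifiedGluing_of_stein (hP1 : HasRank P 1)
    (hStein : ∀ {T : Scheme.{u}} (f : T ⟶ S) (W : T.Opens), Function.Bijective ((A.baseChange f).X.hom.app W)) :
    A.RigidifiedGluing B P :=
  A.rigidifiedGluing_of_cechPic B P hP1 fun f 𝒰 c hloc hε =>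
    A.cechPic_eq_one_of_cover_of_unitSection hStein f 𝒰 c hloc hε

end KeyAssembly


/-! ### §2 Stein for `A₀ × T → T` and rigidified gluing for an abelian variety over a field -/

section OfAbelianVariety

open Literature.AlgebraicGeometry.Motives

/-- **Stein for `A₀ ×_K T → T`**: `Γ(W, 𝒪_T) → Γ(pr⁻¹W, 𝒪_{A₀ × T})` is bijective for every open `W ⊆ T` and every
`K`-scheme `T` (`Motives.PushforwardStructureSheaf.isIso_app_snd`: `A₀ → Spec K` is proper and geometrically integral).
[cite: GortzWedhorn2023, Cor. 24.63 (p. 404)] -/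
theorem stein_ofAbelianVariety {K : Type} [Field K] (A₀ : AbelianVariety K) {T : Scheme.{0}}
    (f : T ⟶ Spec (.of K)) (W : T.Opens) :
    Function.Bijective (((AbelianSchemeOver.ofAbelianVariety A₀).baseChange f).X.hom.app W) := by
  haveI := isIso_app_snd A₀.X.hom f W
  exact ConcreteCategory.bijective_of_isIso ((pullback.snd A₀.X.hom f).app W)

/-- **Rigidified gluing holds for an abelian variety over a field** (and any `B`, any rank-one `𝒫` on
`A₀ × B`): `(ofAbelianVariety A₀).RigidifiedGluing B 𝒫` — the gluing hypothesis of `existsUnique_classify_of_affine`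
(`AbelianSchemes/PoincareUniversalLocality`) in this case. [cite: MumfordAV1970, §13 (proof of the Thm. p. 125)] [cite: MilneAV2008, I §8 (proof of Thm. 8.9)] -/
theorem rigidifiedGluing_ofAbelianVariety {K : Type} [Field K] (A₀ : AbelianVariety K)
    (B : AbelianSchemeOver (Spec (.of K))) (P : ((AbelianSchemeOver.ofAbelianVariety A₀).prodLeft B).Modules)
    (hP1 : HasRank P 1) : (AbelianSchemeOver.ofAbelianVariety A₀).RigidifiedGluing B P :=
  (AbelianSchemeOver.ofAbelianVariety A₀).rigidifiedGluing_of_stein B P hP1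
    fun f W => stein_ofAbelianVariety A₀ f W

end OfAbelianVariety

end AbelianSchemeOver

end Literature.AlgebraicGeometry.AbelianSchemes

end
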